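import Summits.BirchSwinnertonDyer.BirchSwinnertonDyer.Theses.ShaPrimaryTransfer
import Summits.BirchSwinnertonDyer.BirchSwinnertonDyer.Theorems.Rank1ResidualIntModelReduction
import Literature.NumberTheory.EllipticCurves.KubertTate172SqrtNegTwoTwist
import Literature.Barriers.BirchSwinnertonDyer.AnomalousHeegnerLogWall
import Literature.NumberTheory.EllipticCurves.LutzNagellGeneralWeierstrass
import Literature.NumberTheory.EllipticCurves.CastellaGrossiLeeSkinner2022.PConverse
import Literature.NumberTheory.EllipticCurves.IwasawaLeadingTermProofs
import Mathlib.Tactic.NormNum.Prime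
import HarnessLib

/-!
# BirchSwinnertonDyer / ShaPrimaryTransfer — crux `FiniteShaComponentTransfer` (stmt-BirchSwinnertonDyer-22356):
# THE RANK-ONE `ℚ(√−2)` TWIST DOOR `W₂ = E_{17/2}^{(−8)} = [0, −178, 0, 32640, −591872]` — T DISCHARGED MODULO REFEREED PRINT (CGLS Thm. E + GZK)

Helper file of prover seat `bsd-line-spt-p1` g24 (`--supports stmt-22356 --as helper`). THEOREMS ONLY; no definition, no `sorry`.
The tree's `Literature/…/KubertTate172{ShaFive,SqrtNegTwoValuations,SqrtNegTwoDescent,SqrtNegTwoTwist}` (this seat) run the complete `5`-isogeny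
descent of `E_{17/2} = [−15, −34, −68, 0, 0]` over `ℚ` (rank `1`, `t₅ = 0`) and over `K = ℚ(√−2)` (three places `(θ), (3 ± 2θ)`; rank `E(K) = 2`,
`Ш(E ⊗ K)[5^∞] = 0`), whence for the globally minimal twist `W₂` (`Δ = −2²³·17⁵·89`, Kraus-minimal at `2`, `W₂[5]` reducible):
**`rank W₂(ℚ) = 1`, `t₅(W₂) = 0`, `corank_{ℤ₅} Sel_{5^∞}(W₂/ℚ) = 1`** — a curve WITHOUT rational `5`-torsion (`torsionOrder_W₂_eq_one`).

* §1 `frobeniusTrace_five_W₂` (`a₅ = −1`: `#W̃₂(𝔽₅) = 7`), `goodOrdinary_five_W₂`, `printedScope_W₂` (`Red ∧ Good ∧ a₅ ≢ 1`);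
* §2 `torsionOrder_W₂_eq_one` (`#W̃₂(𝔽₅) = 7`, `#W̃₂(𝔽₃) = 5`);
* §3 `oneFiniteShaComponent_W₂` (O, unconditional, witness `5`), `shaCorank_five_W₂`, `transfer_W₂` (T by name);
* §4 **`analyticRank_W₂_eq_one_of_thmE`**, **`finite_sha_W₂_of_thmE`**, **`transfer_W₂_of_thmE`** — granting CGLS Theorem E (`r = 1`, tree named fact
  `thmE_analyticRank_eq_one_of_selmerCorank_eq_one`, PUBLISHED Invent. Math. 2022) and Gross–Zagier–Kolyvagin (`rank_eq_analyticRank_of_analyticRank_le_one`):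
  `ord_{s=1} L(W₂, s) = 1`, `Ш(W₂/ℚ)` finite, and the instance of T at `W₂` HOLDS — **T DISCHARGED at a rank-1 `ℚ(√−2)`-twist modulo refereed print**,
  the `ℚ(√−2)` companion of the Eisenstein rows `W₁, W₂, W₄` of g22 (`…EisensteinTwistDoor`).

T itself is UNCHANGED (conjecture-grade at corank ≥ 2: no `p`-converse exists there) and BSD is NOT proved by any of this.

## References

* [CastellaGrossiLeeSkinner2022] F. Castella, G. Grossi, J. Lee, C. Skinner, Invent. Math. 227 (2022) 517–580, Theorem E = Thm. 5.2.1.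
* [Darmon2004] H. Darmon, *Rational points on modular elliptic curves*, CBMS 101, Thm. 3.22 (Gross–Zagier–Kolyvagin).
* [SilvermanAEC2009] J. H. Silverman, *AEC*, 2nd ed., VII.1 Remark 1.1, VII.5 Prop. 5.1, VIII.8, X.§2, Exercise 10.16.
* [Knapp1993] A. W. Knapp, *Elliptic Curves*, Ch. V §1 Thm. 5.1(c).
-/

-- D-0017: single-problem summit, so `Summit.BirchSwinnertonDyer.BirchSwinnertonDyer.…` repeats a namespace BY DESIGN.
set_option linter.dupNamespace false
set_option autoImplicit false

noncomputable section

open scoped Classical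
open Literature.NumberTheory.EllipticCurves WeierstrassCurve
open Literature.NumberTheory.EllipticCurves.Rank1Residual
open Literature.NumberTheory.EllipticCurves.KubertTate172SqrtNegTwoTwist (isElliptic_model isGloballyMinimal_model)
open Literature.NumberTheory.EllipticCurves.CastellaGrossiLeeSkinner2022
open Summit.BirchSwinnertonDyer.BirchSwinnertonDyer.Theses.ShaPrimaryTransfer
open Summit.BirchSwinnertonDyer.BirchSwinnertonDyer.Rank1Residual

namespace Summit.BirchSwinnertonDyer.BirchSwinnertonDyer.Theorems.ShaPrimaryTransferSqrtNegTwoTwistDoor172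

/-! ## §1 Reduction at `5`: `#W̃₂(𝔽₅) = 7`, `a₅ = −1`, good ordinary, non-anomalous -/

/-- The tree's integral model of `W₂` is the integer equation `[1, 539, −12, −13629, −43797983]` itself. [cite: SilvermanAEC2009, VIII.8] -/
theorem integralModelInt_W₂ :
    haveI := isGloballyMinimal_model
    integralModelInt (⟨((0 : ℤ) : ℚ), ((-178 : ℤ) : ℚ), ((0 : ℤ) : ℚ), ((32640 : ℤ) : ℚ), ((-591872 : ℤ) : ℚ)⟩ : WeierstrassCurve ℚ) =
      ⟨0, -178, 0, 32640, -591872⟩ := by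
  haveI := isGloballyMinimal_model
  exact IntModel.integralModelInt_eq_of_map_eq _ (IntModel.map_mk_int 0 (-178) 0 32640 (-591872))

/-- The reduction modulo `5` of the integer model: `y² = x³ + 2x² + 3` over `𝔽₅`. [folklore] -/
private theorem map_zmod_five :
    (⟨0, -178, 0, 32640, -591872⟩ : WeierstrassCurve ℤ).map (Int.castRingHom (ZMod 5)) =
      (⟨0, 2, 0, 0, 3⟩ : WeierstrassCurve (ZMod 5)) := by
  ext <;> simp [WeierstrassCurve.map] <;> decide

/-- **`#W̃₂(𝔽₅) = 7`**: six affine solutions of `y² = x³ + 2x² + 3` over `𝔽₅` (kernel count), plus `O`.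
[cite: SilvermanAEC2009, V.2] -/
theorem natCard_point_five_W₂ :
    Nat.card (((⟨0, -178, 0, 32640, -591872⟩ : WeierstrassCurve ℤ).map
      (Int.castRingHom (ZMod 5))).toAffine.Point) = 7 := by
  rw [map_zmod_five, natCard_point_eq_one_add_card (F := ZMod 5) _ (by decide)]
  have h : Fintype.card {xy : ZMod 5 × ZMod 5 //
      xy.2 ^ 2 + (⟨0, 2, 0, 0, 3⟩ : WeierstrassCurve (ZMod 5)).a₁ * xy.1 * xy.2 +
        (⟨0, 2, 0, 0, 3⟩ : WeierstrassCurve (ZMod 5)).a₃ * xy.2 =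
      xy.1 ^ 3 + (⟨0, 2, 0, 0, 3⟩ : WeierstrassCurve (ZMod 5)).a₂ * xy.1 ^ 2 +
        (⟨0, 2, 0, 0, 3⟩ : WeierstrassCurve (ZMod 5)).a₄ * xy.1 + (⟨0, 2, 0, 0, 3⟩ : WeierstrassCurve (ZMod 5)).a₆} = 6 := by
    decide +kernel
  rw [h]

/-- **`a₅(W₂) = −1`** (`= 5 + 1 − 7`; `= -a₅(E_{17/18})` since `5` is inert in `ℚ(√−2)`): NON-anomalous (`−1 ≢ 1 (mod 5)`), ordinary.
[cite: SilvermanAEC2009, V.2 and Exercise 10.16] -/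
theorem frobeniusTrace_five_W₂ :
    haveI := isGloballyMinimal_model
    (⟨((0 : ℤ) : ℚ), ((-178 : ℤ) : ℚ), ((0 : ℤ) : ℚ), ((32640 : ℤ) : ℚ), ((-591872 : ℤ) : ℚ)⟩ : WeierstrassCurve ℚ).frobeniusTrace 5 = -1 := by
  haveI := isGloballyMinimal_model
  rw [IntModel.frobeniusTrace_eq integralModelInt_W₂ natCard_point_five_W₂]
  norm_num

/-- **`5` is a prime of good ORDINARY reduction of `W₂`** (`5 ∤ Δ(W₂) = −2²³·17⁵·89`, `5 ∤ a₅ = −1`): the door prime of the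
`ℚ(√−2)`-descent is X2-admissible. [cite: SilvermanAEC2009, VII.5 Prop. 5.1(a)] -/
theorem goodOrdinary_five_W₂ :
    haveI := isGloballyMinimal_model
    haveI : Fact (Nat.Prime 5) := ⟨Nat.prime_five⟩
    (⟨((0 : ℤ) : ℚ), ((-178 : ℤ) : ℚ), ((0 : ℤ) : ℚ), ((32640 : ℤ) : ℚ), ((-591872 : ℤ) : ℚ)⟩ : WeierstrassCurve ℚ).HasGoodReductionAtPrime 5 ∧
      ¬ ((5 : ℕ) : ℤ) ∣ (⟨((0 : ℤ) : ℚ), ((-178 : ℤ) : ℚ), ((0 : ℤ) : ℚ), ((32640 : ℤ) : ℚ), ((-591872 : ℤ) : ℚ)⟩ :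
        WeierstrassCurve ℚ).frobeniusTrace 5 := by
  haveI := isGloballyMinimal_model
  haveI : Fact (Nat.Prime 5) := ⟨Nat.prime_five⟩
  refine ⟨hasGoodReductionAtPrime_of_not_dvd _ 5 ?_, ?_⟩
  · rw [IntModel.minimalDiscriminantInt_eq integralModelInt_W₂]
    have hΔ : (⟨0, -178, 0, 32640, -591872⟩ : WeierstrassCurve ℤ).Δ = -1060045517225984 := by
      norm_num [WeierstrassCurve.Δ, WeierstrassCurve.b₂, WeierstrassCurve.b₄, WeierstrassCurve.b₆, WeierstrassCurve.b₈]
    rw [hΔ]; norm_num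
  · rw [frobeniusTrace_five_W₂]; decide

/-- **`(W₂, 5)` lies INSIDE the printed scope `Red ∧ Good ∧ a₅ ≢ 1 (mod 5)`** of the refereed Eisenstein `5`-converses
(`PrintedEisensteinHeegnerLogScope`, barrier file `AnomalousHeegnerLogWall`; here `a₅ = −1`) — like the Eisenstein doors, unlike every Gaussian-twist door.
[cite: CastellaGrossiLeeSkinner2022, Thm. E (hypothesis φ|G_p ≠ 1, ω)] -/
theorem printedScope_W₂ :
    haveI := isGloballyMinimal_model
    haveI : Fact (Nat.Prime 5) := ⟨Nat.prime_five⟩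
    Literature.Barriers.BirchSwinnertonDyer.PrintedEisensteinHeegnerLogScope
      (⟨((0 : ℤ) : ℚ), ((-178 : ℤ) : ℚ), ((0 : ℤ) : ℚ), ((32640 : ℤ) : ℚ), ((-591872 : ℤ) : ℚ)⟩ : WeierstrassCurve ℚ) 5 := by
  haveI := isElliptic_model
  haveI := isGloballyMinimal_model
  haveI : Fact (Nat.Prime 5) := ⟨Nat.prime_five⟩
  obtain ⟨hgood, -⟩ := goodOrdinary_five_W₂
  refine ⟨KubertTate172SqrtNegTwoTwist.red_five_model, hgood, ?_⟩
  rw [frobeniusTrace_five_W₂]; decide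

/-! ## §2 The rational torsion of `W₂` is trivial -/

/-- The reduction modulo `3` of the integer model: `y² = x³ + 2x² + 1` over `𝔽₃`. [folklore] -/
private theorem map_zmod_three :
    (⟨0, -178, 0, 32640, -591872⟩ : WeierstrassCurve ℤ).map (Int.castRingHom (ZMod 3)) =
      (⟨0, 2, 0, 0, 1⟩ : WeierstrassCurve (ZMod 3)) := by
  ext <;> simp [WeierstrassCurve.map] <;> decide

/-- **`#W̃₂(𝔽₃) = 5`** (`4` affine solutions of `y² = x³ + 2x² + 1` over `𝔽₃`, kernel count, plus `O`). [cite: SilvermanAEC2009, V.2] -/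
theorem natCard_point_three_W₂ :
    Nat.card (((⟨0, -178, 0, 32640, -591872⟩ : WeierstrassCurve ℤ).map
      (Int.castRingHom (ZMod 3))).toAffine.Point) = 5 := by
  rw [map_zmod_three, natCard_point_eq_one_add_card (F := ZMod 3) _ (by decide)]
  have h : Fintype.card {xy : ZMod 3 × ZMod 3 //
      xy.2 ^ 2 + (⟨0, 2, 0, 0, 1⟩ : WeierstrassCurve (ZMod 3)).a₁ * xy.1 * xy.2 +
        (⟨0, 2, 0, 0, 1⟩ : WeierstrassCurve (ZMod 3)).a₃ * xy.2 =
      xy.1 ^ 3 + (⟨0, 2, 0, 0, 1⟩ : WeierstrassCurve (ZMod 3)).a₂ * xy.1 ^ 2 +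
        (⟨0, 2, 0, 0, 1⟩ : WeierstrassCurve (ZMod 3)).a₄ * xy.1 + (⟨0, 2, 0, 0, 1⟩ : WeierstrassCurve (ZMod 3)).a₆} = 4 := by
    decide +kernel
  rw [h]

/-- **`W₂(ℚ)_tors = 0`**: `#W₂(ℚ)_tors` divides `#W̃₂(𝔽₅) = 7` and `#W̃₂(𝔽₃) = 5` (reduction of torsion at the good odd primes `5, 3`,
tree `torsionOrder_dvd_reductionPointCount`), hence equals `1`: the twist has NO rational `5`-torsion — its door at `5` is not a
rational-torsion door. [cite: Knapp1993, Ch. V §1 Thm. 5.1(c)] -/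
theorem torsionOrder_W₂_eq_one :
    haveI := isElliptic_model
    (⟨((0 : ℤ) : ℚ), ((-178 : ℤ) : ℚ), ((0 : ℤ) : ℚ), ((32640 : ℤ) : ℚ), ((-591872 : ℤ) : ℚ)⟩ : WeierstrassCurve ℚ).torsionOrder = 1 := by
  haveI := isElliptic_model
  haveI := isGloballyMinimal_model
  haveI : Fact (Nat.Prime 5) := ⟨Nat.prime_five⟩
  haveI : Fact (Nat.Prime 3) := ⟨by norm_num⟩
  have hΔ : (⟨0, -178, 0, 32640, -591872⟩ : WeierstrassCurve ℤ).Δ = -1060045517225984 := by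
    norm_num [WeierstrassCurve.Δ, WeierstrassCurve.b₂, WeierstrassCurve.b₄, WeierstrassCurve.b₆, WeierstrassCurve.b₈]
  have h5 := LutzNagellGeneral.torsionOrder_dvd_reductionPointCount
    (⟨((0 : ℤ) : ℚ), ((-178 : ℤ) : ℚ), ((0 : ℤ) : ℚ), ((32640 : ℤ) : ℚ), ((-591872 : ℤ) : ℚ)⟩ : WeierstrassCurve ℚ)
    5 (Or.inl (by decide)) (by rw [IntModel.minimalDiscriminantInt_eq integralModelInt_W₂, hΔ]; norm_num)
  have h3 := LutzNagellGeneral.torsionOrder_dvd_reductionPointCount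
    (⟨((0 : ℤ) : ℚ), ((-178 : ℤ) : ℚ), ((0 : ℤ) : ℚ), ((32640 : ℤ) : ℚ), ((-591872 : ℤ) : ℚ)⟩ : WeierstrassCurve ℚ)
    3 (Or.inl (by decide)) (by rw [IntModel.minimalDiscriminantInt_eq integralModelInt_W₂, hΔ]; norm_num)
  rw [WeierstrassCurve.reductionPointCount, integralModelInt_W₂] at h5 h3
  rw [natCard_point_five_W₂] at h5
  rw [natCard_point_three_W₂] at h3
  have h1 : (⟨((0 : ℤ) : ℚ), ((-178 : ℤ) : ℚ), ((0 : ℤ) : ℚ), ((32640 : ℤ) : ℚ), ((-591872 : ℤ) : ℚ)⟩ :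
      WeierstrassCurve ℚ).torsionOrder ∣ Nat.gcd 7 5 := Nat.dvd_gcd h5 h3
  exact Nat.dvd_one.mp (by simpa using h1)

/-! ## §3 O at `W₂` (unconditional) and T by name -/

/-- **O for `W₂` with witness `p₀ = 5`, UNCONDITIONAL** (`t₅(W₂) = 0`; tree `KubertTate172SqrtNegTwoTwist.door_model_cast`, by the
`5`-descent over `ℚ(√−2)` with split primes). [cite: SilvermanAEC2009, Thm. X.4.2] -/
theorem oneFiniteShaComponent_W₂ :
    haveI := isElliptic_model
    ∃ (p : ℕ) (_ : Fact p.Prime),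
      (⟨((0 : ℤ) : ℚ), ((-178 : ℤ) : ℚ), ((0 : ℤ) : ℚ), ((32640 : ℤ) : ℚ), ((-591872 : ℤ) : ℚ)⟩ : WeierstrassCurve ℚ).shaCorank p = 0 := by
  haveI := isElliptic_model
  haveI := isGloballyMinimal_model
  haveI : Fact (Nat.Prime 5) := ⟨Nat.prime_five⟩
  exact ⟨5, inferInstance, KubertTate172SqrtNegTwoTwist.door_model_cast.2⟩

/-- `t₅(W₂) = 0`, unconditional. [cite: SilvermanAEC2009, Thm. X.4.2] -/
theorem shaCorank_five_W₂ :
    haveI := isElliptic_model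
    haveI : Fact (Nat.Prime 5) := ⟨Nat.prime_five⟩
    (⟨((0 : ℤ) : ℚ), ((-178 : ℤ) : ℚ), ((0 : ℤ) : ℚ), ((32640 : ℤ) : ℚ), ((-591872 : ℤ) : ℚ)⟩ : WeierstrassCurve ℚ).shaCorank 5 = 0 := by
  haveI := isElliptic_model
  haveI := isGloballyMinimal_model
  haveI : Fact (Nat.Prime 5) := ⟨Nat.prime_five⟩
  exact KubertTate172SqrtNegTwoTwist.door_model_cast.2

/-- **T BY NAME on `W₂`**: granting `FiniteShaComponentTransfer`, every `t_q(W₂) = 0`. T itself is NOT proved here; at `W₂` (rank `1`) it is discharged modulo CGLS + GZK in §4. [cite: SilvermanAEC2009, Thm. X.4.2] -/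
theorem transfer_W₂ (hT : FiniteShaComponentTransfer) (q : ℕ) [Fact q.Prime] :
    haveI := isElliptic_model
    (⟨((0 : ℤ) : ℚ), ((-178 : ℤ) : ℚ), ((0 : ℤ) : ℚ), ((32640 : ℤ) : ℚ), ((-591872 : ℤ) : ℚ)⟩ : WeierstrassCurve ℚ).shaCorank q = 0 := by
  haveI := isElliptic_model
  obtain ⟨p, hp, h0⟩ := oneFiniteShaComponent_W₂
  exact hT _ p q h0

/-! ## §4 T DISCHARGED at `W₂` modulo refereed print: CGLS Theorem E (`r = 1`) + Gross–Zagier–Kolyvagin -/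

/-- **`ord_{s=1} L(W₂, s) = 1` modulo CGLS Theorem E (`r = 1`)**: `(W₂, 5)` is a non-anomalous Eisenstein pair of good reduction (`Good`, `Red`,
`¬ Anom`: `a₅ = −1`) with `corank_{ℤ₅} Sel_{5^∞}(W₂/ℚ) = 1` certified by descent over `ℚ(√−2)`.
[cite: CastellaGrossiLeeSkinner2022, Theorem E = Thm. 5.2.1 (r = 1)] -/
theorem analyticRank_W₂_eq_one_of_thmE (h : thmE_analyticRank_eq_one_of_selmerCorank_eq_one) :
    haveI := isElliptic_model
    (⟨((0 : ℤ) : ℚ), ((-178 : ℤ) : ℚ), ((0 : ℤ) : ℚ), ((32640 : ℤ) : ℚ), ((-591872 : ℤ) : ℚ)⟩ : WeierstrassCurve ℚ).analyticRank = 1 := by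
  haveI := isElliptic_model
  haveI := isGloballyMinimal_model
  haveI : Fact (Nat.Prime 5) := ⟨Nat.prime_five⟩
  obtain ⟨hred, hgood, hna⟩ := printedScope_W₂
  exact h _ 5 (by norm_num) hgood hred (fun hA ↦ hna hA.2.2) KubertTate172SqrtNegTwoTwist.selmerCorank_five_model

/-- **`Ш(W₂/ℚ)` is finite modulo CGLS Theorem E and Gross–Zagier–Kolyvagin.** [cite: CastellaGrossiLeeSkinner2022, Theorem E ("and so" clause)]
[cite: Darmon2004, Thm. 3.22] -/
theorem finite_sha_W₂_of_thmE (h : thmE_analyticRank_eq_one_of_selmerCorank_eq_one)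
    (hGZK : rank_eq_analyticRank_of_analyticRank_le_one) :
    haveI := isElliptic_model
    Finite (⟨((0 : ℤ) : ℚ), ((-178 : ℤ) : ℚ), ((0 : ℤ) : ℚ), ((32640 : ℤ) : ℚ), ((-591872 : ℤ) : ℚ)⟩ : WeierstrassCurve ℚ).sha := by
  haveI := isElliptic_model
  haveI := isGloballyMinimal_model
  haveI : Fact (Nat.Prime 5) := ⟨Nat.prime_five⟩
  obtain ⟨hred, hgood, hna⟩ := printedScope_W₂
  exact (rank_eq_one_and_finite_sha_of_thmE (p := 5) h hGZK (by norm_num) hgood hred (fun hA ↦ hna hA.2.2)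
    KubertTate172SqrtNegTwoTwist.selmerCorank_five_model).2.2

/-- **T DISCHARGED AT THE RANK-1 CURVE `W₂ = E_{17/2}^{(−8)}` MODULO REFEREED PRINT**: granting CGLS Theorem E (`r = 1`) and Gross–Zagier–Kolyvagin,
the instance of `FiniteShaComponentTransfer` at `W₂` holds — indeed every `t_q(W₂) = 0`.  Everything else (rank `1`, `t₅ = 0`, `a₅ = −1`, reducibility,
minimality) is proved in the tree by descent over `ℚ(√−2)` and kernel arithmetic: the first such row over the third quadratic field.
[cite: CastellaGrossiLeeSkinner2022, Theorem E] [cite: Darmon2004, Thm. 3.22] -/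
theorem transfer_W₂_of_thmE (h : thmE_analyticRank_eq_one_of_selmerCorank_eq_one)
    (hGZK : rank_eq_analyticRank_of_analyticRank_le_one) (p q : ℕ) [Fact p.Prime] [Fact q.Prime] :
    haveI := isElliptic_model
    (⟨((0 : ℤ) : ℚ), ((-178 : ℤ) : ℚ), ((0 : ℤ) : ℚ), ((32640 : ℤ) : ℚ), ((-591872 : ℤ) : ℚ)⟩ : WeierstrassCurve ℚ).shaCorank p = 0 →
      (⟨((0 : ℤ) : ℚ), ((-178 : ℤ) : ℚ), ((0 : ℤ) : ℚ), ((32640 : ℤ) : ℚ), ((-591872 : ℤ) : ℚ)⟩ : WeierstrassCurve ℚ).shaCorank q = 0 := by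
  haveI := isElliptic_model
  intro _
  haveI := finite_sha_W₂_of_thmE h hGZK
  exact (finite_primaryComponent_sha_iff_shaCorank_eq_zero _ q).1 inferInstance

/-- **`ord_{s=1} L(W₂, s) = rank W₂(ℚ) = 1` modulo CGLS Theorem E** (rank `1` unconditional): rank-BSD at `W₂` from refereed print + descent.
[cite: CastellaGrossiLeeSkinner2022, Theorem E] -/
theorem analyticRank_W₂_eq_mordellWeilRank_of_thmE (h : thmE_analyticRank_eq_one_of_selmerCorank_eq_one) :
    haveI := isElliptic_model
    (⟨((0 : ℤ) : ℚ), ((-178 : ℤ) : ℚ), ((0 : ℤ) : ℚ), ((32640 : ℤ) : ℚ), ((-591872 : ℤ) : ℚ)⟩ : WeierstrassCurve ℚ).analyticRank =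
      (⟨((0 : ℤ) : ℚ), ((-178 : ℤ) : ℚ), ((0 : ℤ) : ℚ), ((32640 : ℤ) : ℚ), ((-591872 : ℤ) : ℚ)⟩ : WeierstrassCurve ℚ).mordellWeilRank := by
  haveI := isElliptic_model
  rw [analyticRank_W₂_eq_one_of_thmE h, KubertTate172SqrtNegTwoTwist.door_model_cast.1]

end Summit.BirchSwinnertonDyer.BirchSwinnertonDyer.Theorems.ShaPrimaryTransferSqrtNegTwoTwistDoor172

end
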